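import Summits.Ventures.PercRepro.SixThreePlane
import Summits.Ventures.PercRepro.SixThreeTriple
import Summits.Ventures.PercRepro.SixThreeColoop
import Summits.Ventures.PercRepro.SixThreeP1A

/-!
# Theorem P₁′ for C-025 at `(6, 3)` — part B: the accounting `P1_of_bounds` (p5, gen 7)

Continuation of `SixThreeP1A.lean` (split for the ≤ 400-line lint; proofs byte-identical).  mine-2 §19.4′: six singles
≥ 1/4 (p2's `share_triple_ge`), fifteen pairs ≥ 1/10 − 1/30·[lossy], ≥ 2 repayment triples per lossy pair each ≥ 1/35,
charged to that pair alone; `3/2 + 3/2 − #L/30 + 2#L/35 ≥ 3`.  The share lemmas are hypotheses here (`SixThreeP1.lean`).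
-/

namespace PercRepro

namespace SixThree

namespace P1

open Finset ThmH PerFlat

variable {α : Type*} [DecidableEq α] {M : Matroid α} [M.Finite]

/-- **The accounting of Theorem P₁′** (mine-2 §19.4′), closed modulo the share lemmas `(Sc)` (a lossy pair has
share `≥ 1/15`), `(T)` (a repayment triple is a witness of rank `5` with share `≥ 1/35`, and a lossy pair has its
second point in the closure of the first) and the count (a lossy pair has `≥ 2` repayment points). -/
theorem P1_of_bounds (hs : Simple M) {G T W : Finset α} (hG : G ∈ planes M) (hT : T ⊆ G)
    (hrT : M.eRk (T : Set α) = 3) (hT3 : T.card = 3)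
    (hW : W ⊆ gr M) (hWG : Disjoint W G) (hW6 : W.card = 6)
    (hlossy : ∀ x ∈ W, ∀ x' ∈ W, x ≠ x' → M.eRk ((insert x (insert x' T) : Finset α) : Set α) = 4 →
      (1 / 15 : ℚ) ≤ share M G (insert x (insert x' T)))
    (hcl : ∀ x ∈ W, ∀ x' ∈ W, x ≠ x' → M.eRk ((insert x (insert x' T) : Finset α) : Set α) = 4 →
      x' ∈ clF M (insert x T))
    (htriple : ∀ x ∈ W, ∀ x' ∈ W, ∀ y ∈ W, x ≠ x' → y ≠ x → y ≠ x' →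
      M.eRk ((insert x (insert x' T) : Finset α) : Set α) = 4 → y ∉ clF M (insert x (insert x' T)) →
      M.eRk ((insert y (insert x (insert x' T)) : Finset α) : Set α) = 5 ∧
        (1 / 35 : ℚ) ≤ share M G (insert y (insert x (insert x' T))))
    (hcount : ∀ x ∈ W, ∀ x' ∈ W, x ≠ x' → M.eRk ((insert x (insert x' T) : Finset α) : Set α) = 4 →
      2 ≤ (W.filter fun y => y ≠ x ∧ y ≠ x' ∧ y ∉ clF M (insert x (insert x' T))).card) :
    (3 : ℚ) ≤ ∑ S ∈ (Yq M 6 3).filter (fun S => S ∩ G = T ∧ S \ G ⊆ W), share M G S := by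
  classical
  have hTg : T ⊆ gr M := hT.trans (mem_planes.1 hG).1
  have hWT : Disjoint W T := Finset.disjoint_of_subset_right hT hWG
  have hWG' : ∀ x ∈ W, x ∉ G := fun x hx => Finset.disjoint_left.1 hWG hx
  have hWT' : ∀ x ∈ W, x ∉ T := fun x hx => Finset.disjoint_left.1 hWT hx
  have hnonneg : ∀ S, 0 ≤ share M G S := fun S => div_nonneg (fRule_nonneg M G S) (D_nonneg M S)
  -- the witness family
  set Y := (Yq M 6 3).filter (fun S => S ∩ G = T ∧ S \ G ⊆ W) with hYdef
  -- ### singles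
  set T₁ := W.image (fun x => insert x T) with hT₁
  have hinj₁ : Set.InjOn (fun x => insert x T) (W : Set α) := by
    intro x hx x' hx' h
    simp only at h
    have : x ∈ insert x' T := by rw [← h]; exact Finset.mem_insert_self _ _
    rw [Finset.mem_insert] at this
    rcases this with rfl | hxT
    · rfl
    · exact absurd hxT (hWT' x hx)
  have hT₁sub : T₁ ⊆ Y := by
    intro S hS
    rw [hT₁, Finset.mem_image] at hS
    obtain ⟨x, hx, rfl⟩ := hS
    rw [hYdef, Finset.mem_filter, mem_Yq_six_three]
    have hr4 := eRk_insert_eq_four hG hT hrT (hW hx) (hWG' x hx)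
    refine ⟨⟨Finset.insert_subset (hW hx) hTg, by rw [hr4]; decide, by rw [hr4]; decide⟩,
      single_inter_eq hT (hWG' x hx), sdiff_subset_of_subset_union hT
        (Finset.insert_subset (Finset.mem_union_left _ hx) Finset.subset_union_right)⟩
  have hsum₁ : (6 : ℚ) * (1 / 4) ≤ ∑ S ∈ T₁, share M G S := by
    rw [hT₁, Finset.sum_image hinj₁]
    calc (6 : ℚ) * (1 / 4) = ∑ _x ∈ W, (1 / 4 : ℚ) := by
          rw [Finset.sum_const, hW6, nsmul_eq_mul]; norm_num
      _ ≤ ∑ x ∈ W, share M G (insert x T) := by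
          apply Finset.sum_le_sum
          intro x hx
          obtain ⟨x', hx', hne⟩ : ∃ x' ∈ W, x' ≠ x := by
            by_contra hcon
            push Not at hcon
            have : W ⊆ {x} := fun z hz => by rw [Finset.mem_singleton]; exact hcon z hz
            have := Finset.card_le_card this
            rw [hW6, Finset.card_singleton] at this
            omega
          exact (share_triple_ge hs hG hT hrT hT3 (hW hx) (hW hx') hne.symm (hWG' x hx)
            (hWG' x' hx')).1
  -- ### pairs: the lossy ones
  set L := (W.powersetCard 2).filter (fun X => M.eRk ((X ∪ T : Finset α) : Set α) = 4) with hLdef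
  set T₂ := (W.powersetCard 2).image (fun X => X ∪ T) with hT₂
  have hinj₂ : Set.InjOn (fun X => X ∪ T) ((W.powersetCard 2 : Finset (Finset α)) : Set (Finset α)) := by
    intro X hX X' hX' h
    simp only [Finset.mem_coe, Finset.mem_powersetCard] at hX hX'
    simp only at h
    have hXT : Disjoint X T := Finset.disjoint_of_subset_left hX.1 hWT
    have hX'T : Disjoint X' T := Finset.disjoint_of_subset_left hX'.1 hWT
    rw [← Finset.union_sdiff_cancel_right hXT, ← Finset.union_sdiff_cancel_right hX'T, h]
  have hpair_rank : ∀ X ∈ W.powersetCard 2, M.eRk ((X ∪ T : Finset α) : Set α) = 4 ∨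
      M.eRk ((X ∪ T : Finset α) : Set α) = 5 := by
    intro X hX
    rw [Finset.mem_powersetCard] at hX
    obtain ⟨x, x', hxx', rfl⟩ := Finset.card_eq_two.1 hX.2
    have hx : x ∈ W := hX.1 (by simp)
    have hx' : x' ∈ W := hX.1 (by simp)
    rw [pair_union_eq]
    have hr4 := eRk_insert_eq_four hG hT hrT (hW hx') (hWG' x' hx')
    have hge : (4 : ℕ∞) ≤ M.eRk ((insert x (insert x' T) : Finset α) : Set α) := by
      rw [← hr4]
      exact M.eRk_mono (Finset.coe_subset.2 (Finset.subset_insert _ _))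
    have hle : M.eRk ((insert x (insert x' T) : Finset α) : Set α) ≤ 5 := by
      have := eRk_pair_insert_le (M := M) T x x'
      rw [hrT] at this
      exact this.trans (by norm_num)
    have hne : M.eRk ((insert x (insert x' T) : Finset α) : Set α) ≠ ⊤ :=
      ne_top_of_le_ne_top (ENat.coe_ne_top 5) hle
    obtain ⟨n, hn⟩ := ENat.ne_top_iff_exists.mp hne
    rw [← hn] at hge hle ⊢
    norm_cast at hge hle ⊢
    omega
  have hT₂sub : T₂ ⊆ Y := by
    intro S hS
    rw [hT₂, Finset.mem_image] at hS
    obtain ⟨X, hX, rfl⟩ := hS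
    have hr := hpair_rank X hX
    rw [Finset.mem_powersetCard] at hX
    obtain ⟨x, x', hxx', rfl⟩ := Finset.card_eq_two.1 hX.2
    have hx : x ∈ W := hX.1 (by simp)
    have hx' : x' ∈ W := hX.1 (by simp)
    rw [pair_union_eq] at hr ⊢
    rw [hYdef, Finset.mem_filter, mem_Yq_six_three]
    refine ⟨⟨Finset.insert_subset (hW hx) (Finset.insert_subset (hW hx') hTg), ?_, ?_⟩,
      pair_inter_eq hT (hWG' x hx) (hWG' x' hx'), sdiff_subset_of_subset_union hT
        (Finset.insert_subset (Finset.mem_union_left _ hx)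
          (Finset.insert_subset (Finset.mem_union_left _ hx') Finset.subset_union_right))⟩
    · rcases hr with hr | hr <;> rw [hr] <;> decide
    · rcases hr with hr | hr <;> rw [hr] <;> decide
  -- each pair has share `≥ 1/10`, minus `1/30` if lossy
  have hsum₂ : (15 : ℚ) * (1 / 10) - (L.card : ℚ) * (1 / 30) ≤ ∑ S ∈ T₂, share M G S := by
    rw [hT₂, Finset.sum_image hinj₂]
    have hsplit : ∑ X ∈ W.powersetCard 2, share M G (X ∪ T) ≥
        ∑ X ∈ W.powersetCard 2, ((1 / 10 : ℚ) - if X ∈ L then (1 / 30 : ℚ) else 0) := by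
      apply Finset.sum_le_sum
      intro X hX
      have hr := hpair_rank X hX
      have hX' := hX
      rw [Finset.mem_powersetCard] at hX'
      obtain ⟨x, x', hxx', rfl⟩ := Finset.card_eq_two.1 hX'.2
      have hx : x ∈ W := hX'.1 (by simp)
      have hx' : x' ∈ W := hX'.1 (by simp)
      rw [pair_union_eq] at hr ⊢
      by_cases hmem : ({x, x'} : Finset α) ∈ L
      · rw [if_pos hmem]
        rw [hLdef, Finset.mem_filter, pair_union_eq] at hmem
        have := hlossy x hx x' hx' hxx' hmem.2
        linarith
      · rw [if_neg hmem]
        have hr5 : M.eRk ((insert x (insert x' T) : Finset α) : Set α) = 5 := by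
          rcases hr with hr | hr
          · exfalso
            apply hmem
            rw [hLdef, Finset.mem_filter, pair_union_eq]
            exact ⟨hX, hr⟩
          · exact hr
        have := (share_triple_ge hs hG hT hrT hT3 (hW hx) (hW hx') hxx' (hWG' x hx)
          (hWG' x' hx')).2.2 hr5
        linarith
    have hL : L ⊆ W.powersetCard 2 := Finset.filter_subset _ _
    have hsum_ite : ∑ X ∈ W.powersetCard 2, ((1 / 10 : ℚ) - if X ∈ L then (1 / 30 : ℚ) else 0) =
        (15 : ℚ) * (1 / 10) - (L.card : ℚ) * (1 / 30) := by
      rw [Finset.sum_sub_distrib, Finset.sum_const, Finset.card_powersetCard, hW6, nsmul_eq_mul,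
        ← Finset.sum_filter, Finset.filter_mem_eq_inter, Finset.inter_eq_right.2 hL,
        Finset.sum_const, nsmul_eq_mul]
      norm_num [Nat.choose]
    rw [← hsum_ite]
    exact hsplit
  -- ### the repayment triples: for a lossy pair `X`, the triples `X ∪ {y}` with `y ∉ cl(T ∪ X)`
  set rep : Finset α → Finset (Finset α) := fun X =>
    (W.powersetCard 3).filter (fun Z => X ⊆ Z ∧ ∀ y ∈ Z \ X, y ∉ clF M (X ∪ T)) with hrep
  -- the points of a lossy pair
  have hpair : ∀ X ∈ L, ∃ x x', x ∈ W ∧ x' ∈ W ∧ x ≠ x' ∧ X = {x, x'} ∧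
      M.eRk ((insert x (insert x' T) : Finset α) : Set α) = 4 := by
    intro X hX
    rw [hLdef, Finset.mem_filter, Finset.mem_powersetCard] at hX
    obtain ⟨⟨hXW, hX2⟩, hr⟩ := hX
    obtain ⟨x, x', hxx', rfl⟩ := Finset.card_eq_two.1 hX2
    rw [pair_union_eq] at hr
    exact ⟨x, x', hXW (by simp), hXW (by simp), hxx', rfl, hr⟩
  -- a member of `rep X` is `X ∪ {y}` with `y ∈ W ∖ X` outside the closure
  have hmem_rep : ∀ X ∈ L, ∀ Z ∈ rep X, ∃ y, y ∈ W ∧ y ∉ X ∧ Z = insert y X ∧ y ∉ clF M (X ∪ T) := by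
    intro X hX Z hZ
    obtain ⟨x, x', hx, hx', hxx', rfl, hr⟩ := hpair X hX
    rw [hrep] at hZ
    simp only [Finset.mem_filter, Finset.mem_powersetCard] at hZ
    obtain ⟨⟨hZW, hZ3⟩, hXZ, hcl'⟩ := hZ
    have hcard : (Z \ {x, x'}).card = 1 := by
      rw [Finset.card_sdiff, Finset.inter_eq_left.2 hXZ, hZ3, Finset.card_pair hxx']
    obtain ⟨y, hy⟩ := Finset.card_eq_one.1 hcard
    have hyZ : y ∈ Z \ {x, x'} := by rw [hy]; exact Finset.mem_singleton_self y
    rw [Finset.mem_sdiff] at hyZ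
    refine ⟨y, hZW hyZ.1, hyZ.2, ?_, hcl' y (by rw [hy]; exact Finset.mem_singleton_self y)⟩
    -- `Z = insert y {x, x'}`
    have h1 : Z = (Z \ {x, x'}) ∪ {x, x'} := (Finset.sdiff_union_of_subset hXZ).symm
    rw [h1, hy, Finset.singleton_union]
  -- count: `rep X` has at least two members
  have hrep_card : ∀ X ∈ L, 2 ≤ (rep X).card := by
    intro X hX
    obtain ⟨x, x', hx, hx', hxx', rfl, hr⟩ := hpair X hX
    have hc := hcount x hx x' hx' hxx' hr
    refine le_trans hc (Finset.card_le_card_of_injOn (fun y => insert y {x, x'}) ?_ ?_)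
    · intro y hy
      simp only [Finset.coe_filter, Set.mem_setOf_eq] at hy
      obtain ⟨hyW, hyx, hyx', hycl⟩ := hy
      rw [hrep]
      simp only [Finset.coe_filter, Set.mem_setOf_eq, Finset.mem_powersetCard]
      refine ⟨⟨?_, ?_⟩, Finset.subset_insert _ _, ?_⟩
      · exact Finset.insert_subset hyW (Finset.insert_subset hx (Finset.singleton_subset_iff.2 hx'))
      · rw [Finset.card_insert_of_notMem (by simp [hyx, hyx']), Finset.card_pair hxx']
      · intro z hz
        rw [Finset.mem_sdiff, Finset.mem_insert] at hz
        rcases hz.1 with rfl | hz1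
        · rw [pair_union_eq]
          exact hycl
        · exact absurd hz1 hz.2
    · intro y hy y' hy' h
      simp only [Finset.coe_filter, Set.mem_setOf_eq] at hy hy'
      simp only at h
      have : y ∈ insert y' ({x, x'} : Finset α) := by rw [← h]; exact Finset.mem_insert_self _ _
      rw [Finset.mem_insert, Finset.mem_insert, Finset.mem_singleton] at this
      rcases this with h1 | h1 | h1
      · exact h1
      · exact absurd h1 hy.2.1
      · exact absurd h1 hy.2.2.1
  -- each repayment triple is a witness of share `≥ 1/35`
  have hrep_share : ∀ X ∈ L, ∀ Z ∈ rep X, Z ∪ T ∈ Y ∧ (1 / 35 : ℚ) ≤ share M G (Z ∪ T) := by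
    intro X hX Z hZ
    obtain ⟨x, x', hx, hx', hxx', rfl, hr⟩ := hpair X hX
    obtain ⟨y, hy, hyX, rfl, hycl⟩ := hmem_rep _ hX Z hZ
    have hyx : y ≠ x := fun h => hyX (by rw [h]; simp)
    have hyx' : y ≠ x' := fun h => hyX (by rw [h]; simp)
    rw [pair_union_eq] at hycl
    have heq : insert y ({x, x'} : Finset α) ∪ T = insert y (insert x (insert x' T)) := by
      ext z
      simp only [Finset.mem_union, Finset.mem_insert, Finset.mem_singleton]
      tauto
    rw [heq]
    obtain ⟨hr5, hsh⟩ := htriple x hx x' hx' y hy hxx' hyx hyx' hr hycl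
    refine ⟨?_, hsh⟩
    rw [hYdef, Finset.mem_filter, mem_Yq_six_three]
    refine ⟨⟨Finset.insert_subset (hW hy) (Finset.insert_subset (hW hx)
      (Finset.insert_subset (hW hx') hTg)), by rw [hr5]; decide, by rw [hr5]; decide⟩,
      triple_inter_eq hT (hWG' x hx) (hWG' x' hx') (hWG' y hy), sdiff_subset_of_subset_union hT
        (Finset.insert_subset (Finset.mem_union_left _ hy) (Finset.insert_subset (Finset.mem_union_left _ hx)
          (Finset.insert_subset (Finset.mem_union_left _ hx') Finset.subset_union_right)))⟩
  -- the repayment families of distinct lossy pairs are disjoint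
  have hrep_disj : ∀ X ∈ L, ∀ X' ∈ L, X ≠ X' → Disjoint (rep X) (rep X') := by
    intro X hX X' hX' hne
    rw [Finset.disjoint_left]
    intro Z hZ hZ'
    obtain ⟨y, hy, hyX, hZy, hycl⟩ := hmem_rep X hX Z hZ
    obtain ⟨y', hy', hy'X', hZy', hy'cl⟩ := hmem_rep X' hX' Z hZ'
    obtain ⟨x, x', hx, hx', hxx', hXeq, hr⟩ := hpair X hX
    obtain ⟨u, u', hu, hu', huu', hX'eq, hr'⟩ := hpair X' hX'
    -- `y ∈ X'` (else `X' ⊆ X`, so `X' = X`)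
    have hyX' : y ∈ X' := by
      by_contra hyX'
      apply hne
      have hsub : X' ⊆ X := by
        intro z hz
        have hzZ : z ∈ Z := by rw [hZy']; exact Finset.mem_insert_of_mem hz
        rw [hZy, Finset.mem_insert] at hzZ
        rcases hzZ with rfl | hzX
        · exact absurd hz hyX'
        · exact hzX
      have hcX : X.card = 2 := by rw [hXeq]; exact Finset.card_pair hxx'
      have hcX' : X'.card = 2 := by rw [hX'eq]; exact Finset.card_pair huu'
      exact (Finset.eq_of_subset_of_card_le hsub (by omega)).symm
    -- the other point `u₀` of `X'` lies in `X`, and `y ∈ cl(T ∪ u₀) ⊆ cl(T ∪ X)`: contradiction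
    have hrX' : M.eRk ((X' ∪ T : Finset α) : Set α) = 4 := by
      rw [hX'eq, pair_union_eq]
      exact hr'
    have hX'W : X' ⊆ W := by
      rw [hX'eq]
      exact Finset.insert_subset hu (Finset.singleton_subset_iff.2 hu')
    obtain ⟨u₀, hu₀, hu₀y⟩ : ∃ u₀ ∈ X', u₀ ≠ y := by
      rw [hX'eq]
      by_cases h : u = y
      · exact ⟨u', by simp, by rw [← h]; exact huu'.symm⟩
      · exact ⟨u, by simp, h⟩
    have hu₀W : u₀ ∈ W := hX'W hu₀
    have hu₀Z : u₀ ∈ Z := by rw [hZy']; exact Finset.mem_insert_of_mem hu₀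
    have hu₀X : u₀ ∈ X := by
      rw [hZy, Finset.mem_insert] at hu₀Z
      rcases hu₀Z with h | h
      · exact absurd h hu₀y
      · exact h
    have hX'eq' : X' = {u₀, y} := by
      have hc : X'.card = 2 := by rw [hX'eq]; exact Finset.card_pair huu'
      have hsub : ({u₀, y} : Finset α) ⊆ X' :=
        Finset.insert_subset hu₀ (Finset.singleton_subset_iff.2 hyX')
      exact (Finset.eq_of_subset_of_card_le hsub (by rw [Finset.card_pair hu₀y]; omega)).symm
    have hr'' : M.eRk ((insert u₀ (insert y T) : Finset α) : Set α) = 4 := by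
      rw [← pair_union_eq, ← hX'eq']
      exact hrX'
    have hycl' : y ∈ clF M (insert u₀ T) := hcl u₀ hu₀W y hy hu₀y hr''
    have hsub : insert u₀ T ⊆ X ∪ T :=
      Finset.insert_subset (Finset.mem_union_left _ hu₀X) Finset.subset_union_right
    exact hycl (clF_subset_clF_of_subset hsub hycl')
  -- ### assembly
  set R := L.biUnion rep with hRdef
  have hR_card : 2 * L.card ≤ R.card := by
    rw [hRdef, Finset.card_biUnion hrep_disj]
    calc 2 * L.card = ∑ _X ∈ L, 2 := by rw [Finset.sum_const, smul_eq_mul, mul_comm]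
      _ ≤ ∑ X ∈ L, (rep X).card := Finset.sum_le_sum hrep_card
  have hR_sub : R ⊆ W.powersetCard 3 := by
    intro Z hZ
    rw [hRdef, Finset.mem_biUnion] at hZ
    obtain ⟨X, _, hZ⟩ := hZ
    rw [hrep, Finset.mem_filter] at hZ
    exact hZ.1
  have hR_share : ∀ Z ∈ R, Z ∪ T ∈ Y ∧ (1 / 35 : ℚ) ≤ share M G (Z ∪ T) := by
    intro Z hZ
    rw [hRdef, Finset.mem_biUnion] at hZ
    obtain ⟨X, hX, hZ⟩ := hZ
    exact hrep_share X hX Z hZ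
  set T₃ := R.image (fun Z => Z ∪ T) with hT₃
  have hinj₃ : Set.InjOn (fun Z => Z ∪ T) (R : Set (Finset α)) := by
    intro Z hZ Z' hZ' h
    have hZW : Z ⊆ W := (Finset.mem_powersetCard.1 (hR_sub hZ)).1
    have hZ'W : Z' ⊆ W := (Finset.mem_powersetCard.1 (hR_sub hZ')).1
    simp only at h
    have hZT : Disjoint Z T := Finset.disjoint_of_subset_left hZW hWT
    have hZ'T : Disjoint Z' T := Finset.disjoint_of_subset_left hZ'W hWT
    rw [← Finset.union_sdiff_cancel_right hZT, ← Finset.union_sdiff_cancel_right hZ'T, h]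
  have hT₃sub : T₃ ⊆ Y := by
    intro S hS
    rw [hT₃, Finset.mem_image] at hS
    obtain ⟨Z, hZ, rfl⟩ := hS
    exact (hR_share Z hZ).1
  have hsum₃ : (R.card : ℚ) * (1 / 35) ≤ ∑ S ∈ T₃, share M G S := by
    rw [hT₃, Finset.sum_image hinj₃]
    calc (R.card : ℚ) * (1 / 35) = ∑ _Z ∈ R, (1 / 35 : ℚ) := by
          rw [Finset.sum_const, nsmul_eq_mul]
      _ ≤ ∑ Z ∈ R, share M G (Z ∪ T) := Finset.sum_le_sum fun Z hZ => (hR_share Z hZ).2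
  -- the three families are disjoint (sizes `4`, `5`, `6`)
  have hcard₁ : ∀ S ∈ T₁, S.card = 4 := by
    intro S hS
    rw [hT₁, Finset.mem_image] at hS
    obtain ⟨x, hx, rfl⟩ := hS
    rw [Finset.card_insert_of_notMem (hWT' x hx), hT3]
  have hcard₂ : ∀ S ∈ T₂, S.card = 5 := by
    intro S hS
    rw [hT₂, Finset.mem_image] at hS
    obtain ⟨X, hX, rfl⟩ := hS
    rw [Finset.mem_powersetCard] at hX
    rw [Finset.card_union_of_disjoint (Finset.disjoint_of_subset_left hX.1 hWT), hX.2, hT3]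
  have hcard₃ : ∀ S ∈ T₃, S.card = 6 := by
    intro S hS
    rw [hT₃, Finset.mem_image] at hS
    obtain ⟨Z, hZ, rfl⟩ := hS
    have hZ' := Finset.mem_powersetCard.1 (hR_sub hZ)
    rw [Finset.card_union_of_disjoint (Finset.disjoint_of_subset_left hZ'.1 hWT), hZ'.2, hT3]
  have hd₁₂ : Disjoint T₁ T₂ := by
    rw [Finset.disjoint_left]
    intro S h1 h2
    have := hcard₁ S h1
    have := hcard₂ S h2
    omega
  have hd₁₂₃ : Disjoint (T₁ ∪ T₂) T₃ := by
    rw [Finset.disjoint_left]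
    intro S h12 h3
    have h3' := hcard₃ S h3
    rw [Finset.mem_union] at h12
    rcases h12 with h1 | h2
    · have := hcard₁ S h1
      omega
    · have := hcard₂ S h2
      omega
  -- the accounting
  have hLR : (2 * L.card : ℚ) ≤ R.card := by exact_mod_cast hR_card
  calc (3 : ℚ) ≤ (6 : ℚ) * (1 / 4) + ((15 : ℚ) * (1 / 10) - (L.card : ℚ) * (1 / 30)) +
        (R.card : ℚ) * (1 / 35) := by
        have : (0 : ℚ) ≤ L.card := by positivity
        nlinarith
    _ ≤ ∑ S ∈ T₁, share M G S + ∑ S ∈ T₂, share M G S + ∑ S ∈ T₃, share M G S :=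
        add_le_add (add_le_add hsum₁ hsum₂) hsum₃
    _ = ∑ S ∈ T₁ ∪ T₂ ∪ T₃, share M G S := by
        rw [Finset.sum_union hd₁₂₃, Finset.sum_union hd₁₂]
    _ ≤ ∑ S ∈ Y, share M G S := by
        apply Finset.sum_le_sum_of_subset_of_nonneg
          (Finset.union_subset (Finset.union_subset hT₁sub hT₂sub) hT₃sub)
        intro S _ _
        exact hnonneg S

end P1

end SixThree

end PercRepro
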